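import Literature.NumberTheory.EllipticCurves.BhargavaSkinnerZhang2014.Pieces
import Literature.NumberTheory.EllipticCurves.LeadingTermBSZRankOneH9Proofs
import Literature.NumberTheory.EllipticCurves.LeadingTermBSZRankZeroMultiplicativeLegProofs
import Literature.NumberTheory.EllipticCurves.LocalPointsPlaceTransportProofs
import Literature.NumberTheory.EllipticCurves.SelmerTrivialCorankProofs
import HarnessLib

/-!
# The class-theorem binders `h9`, `hker`, `hWtors` (and `h5` on the multiplicative half) of
# `bsz_rankLeOne_cRank_of_pieces` ON THE PIECES of `BhargavaSkinnerZhang2014/Pieces.lean`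

Sibling *proofs* file (theorems only: no definition, no named fact; D-0014 / D-0026, debt `+0`)
of `Literature/NumberTheory/EllipticCurves/BhargavaSkinnerZhang2014/Pieces.lean`, which
instantiates the abstract pieces `S₀ T R P S₁ W` and `Z` of the tree's theorem of record

> `Literature.NumberTheory.EllipticCurves.bsz_rankLeOne_cRank_of_pieces`
> (`LeadingTermBSZResCellAssemblyProofs.lean`): M. Bhargava, C. Skinner, W. Zhang,
> arXiv:1407.1826v2 (2014), proof of Cor. 26 (pp. 10–13) with a fourth piece counted through
> M. Bhargava, C. Skinner, J. Ramanujan Math. Soc. 29 (2014), Thm. 7 (ii) / Lemma 16 — the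
> bundle `pub-bsdpct`'s Theorem A′, `HeightDensityGE SatisfiesBSDRankLeOne 0.66856…`,

by `S₀ := Pieces.S₀` (`5 ∤ A`), `T := Pieces.S₁'` (`S₀(5) ∩ S₁'(5)` of §3.1), `S₁ := Pieces.S₁Cond`
(the bullet of `S₁(5)`), `R := Pieces.T₅`, `P := Pieces.SP' K`, `W := Pieces.W₅` (Lemma 20 in the
(sur) + two-ramified-primes form), `Z := Pieces.Z v` (`ker res₅`). This file specialises the
LANDED kernel glue to these pieces — each theorem below has, after its named-fact hypotheses,
EXACTLY the shape of the corresponding binder of `bsz_rankLeOne_cRank_of_pieces`: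

* `h9_pieces` — binder `h9` (`∀ AB, IsInHeightFamily AB → T AB → S₁ AB → W AB → #Sel₅ = 5 →
  rank = 1 ∧ analytic rank = 1`), from `bsz_h9_five_of_zhang_of_skinnerZhang`
  (`LeadingTermBSZRankOneH9Proofs`, p374374: BSZ Thm. 9 on both legs of hypothesis (a)), below
  `hZ` = W. Zhang, Camb. J. Math. 2 (2014) Thm. 1.4 (i) AS PRINTED (PUB; registry A322), `hSZ` =
  Skinner–Zhang arXiv:1407.1099v1 Thm. 1.1 — an explicitly labelled OPEN hypothesis (unrefereed
  PREPRINT; registry A326, «literal-PRE») used on the multiplicative-at-`5` half of `T` only —,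
  and the Cassels–Tate pairing `hCT` (registry A24); a global minimal model of `E_{A,B}` is taken
  inside (`hasGlobalMinimalModel_rat_holds`, Silverman VIII.8 Cor. 8.3).
* `hker_pieces` — binder `hker` (`∀ AB, IsInHeightFamily AB → P AB → #Sel₅(E_{A,B}) ≤ 5·#Z(E_{A,B})`),
  UNCONDITIONAL: `natCard_selmerGroup_shortWeierstrass_le_mul` (`SelmerLocalRestrictionKernel`,
  p370911) with the local input `E_{A,B}(ℚ₅)[5] = 0` read off the clause
  `Pieces.LocallyTorsionFree` of `P = SP'_K` and moved to the place `v`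
  (`natCard_ker_nsmul_adicCompletion_eq_one_of_forall_padic`, `LocalPointsPlaceTransportProofs`) —
  the composition of `SelmerBoundLocalTorsionTransportProofs` (p374181), re-done here on its two parents.
* `hWtors_pieces` — binder `hWtors` (`∀ AB, IsInHeightFamily AB → W AB → E_{A,B}(ℚ)[5] = ⊥`),
  UNCONDITIONAL: (sur) ⟹ (irr) (`hasIrreducibleModPGaloisRep_of_hasSurjectiveModNGaloisRep`) ⟹ no
  rational `5`-torsion (`bsz_hWtors_five_of_irreducible`, `SelmerTrivialCorankProofs`, p369097).
* `h5_pieces_multiplicative` — binder `h5` (`∀ AB, IsInHeightFamily AB → S₀ AB → W AB →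
  #Sel₅ = 1 → rank = 0 ∧ analytic rank = 0`) on the MULTIPLICATIVE half `5 ∣ 4A³ + 27B²` of
  `S₀(5)`, from `bsz_h5_multiplicative_five_of_thmA` (`LeadingTermBSZRankZeroMultiplicativeLegProofs`,
  p373565), below modularity `hmod`, Skinner 2016 Thm. A `hA` (registry A31), Greenberg's §4
  formulas `hGs` / `hGn` (A236 / A235) and Greenberg–Stevens at `5` (`hGS`). The GOOD-ORDINARY half
  (`5 ∤ 4A³ + 27B²`; Skinner–Urban / Burungale–Castella–Skinner route) is the row
  `b2b-bsdres-additive-p1`'s `LeadingTermBSZRankZeroLegProofs` (p374010, pending at the time of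
  writing); the two-leg `h5_pieces` is added here once that file is in the tree.

Also: `W₅.irreducible` ((sur) ⟹ (irr) on `W`), `W₅.not_hasCM` (non-CM on `W`, for Kim's theorem
on `P`: tree `not_hasCM_of_hasMultiplicativeReductionAtPrime'` at one of the two ramified
multiplicative primes).

AS-USED vs AS-PRINTED, and status: as in the docstrings of the three glue files — `h9`'s
good-ordinary half rests on PUBLISHED inputs (Zhang 2014, Cassels–Tate), its multiplicative half
on an OPEN preprint claim taken BY NAME (`SkinnerZhang2014.thm1_1_rank_one_of_selmerCorank_eq_one_OPEN`);
`hker`, `hWtors` are unconditional; `h5` (multiplicative half) rests on Skinner 2016 Thm. A,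
Greenberg 1999 §4, modularity and Greenberg–Stevens. What is NOT done here: `hKim` on `P` (Kim 2023
Thm. 1.1 at a MULTIPLICATIVE prime with (IMC[1/p]) = the bundle's Prop. 3.4 — cell book row Q3,
D1/D2 items), the good-ordinary half of `h5`, any density (group (B)), the re-keyed assembly
`bsz_rankLeOne_cRank_of_facts`. BSD-DENSITY SPRINT (cell `b2b-bsdres`, book
`cells/density/CONVERSION-QUEUE.md` §1 item C0 / §2 rows Q1, Q2, Q4, Q7), interim writer = row
`eisenstein-p2` on the cell lead's WAKE `C0-pieces`. HONEST FRAMING: kernel glue below NAMED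
inputs, one of them an OPEN preprint claim; nothing is booked; no density number, RESIDUAL-MAP
mark, tier or status word moves by this file; this is not "finishing BSD".

## References

* [BhargavaSkinnerZhang2014] M. Bhargava, C. Skinner, W. Zhang, arXiv:1407.1826v2: Thm. 5, Thm. 9
  (§2.1–2.2, p. 5), §3.1 (p. 8), Lemma 20 (p. 10), proof of Cor. 26 (pp. 10–13).
* [BhargavaSkinner2014] M. Bhargava, C. Skinner, J. Ramanujan Math. Soc. 29 (2014): Thm. 7 (ii),
  proof of Lemma 16.
* [WZhang2014] W. Zhang, Camb. J. Math. 2 (2014) 191–253, Thm. 1.4 (i).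
* [SkinnerZhang2014] C. Skinner, W. Zhang, arXiv:1407.1099v1, Thm. 1.1 — PREPRINT.
* [Skinner2016PacificMC] C. Skinner, Pacific J. Math. 283 (2016) 171–200, Thm. A, Thm. C.
* [SilvermanAEC2009] J. H. Silverman, *The Arithmetic of Elliptic Curves*, 2nd ed., VIII.8 Cor. 8.3,
  X.4.14.
-/

set_option autoImplicit false

noncomputable section

open scoped Classical
open scoped AddSubgroup

open WeierstrassCurve NumberField IsDedekindDomain
open Literature.NumberTheory.EllipticCurves.ModularForms
open Literature.NumberTheory.EllipticCurves.BhargavaSkinnerZhang2014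

namespace Literature.NumberTheory.EllipticCurves.BhargavaSkinnerZhang2014.Pieces

/-! ### `W`: (sur) ⟹ (irr) ⟹ no rational `5`-torsion; non-CM -/

/-- `W ∋ E_{A,B}` in the height family gives (irr) at `5` (Lemma 20's first property as printed;
Thm. 5 (b), Thm. 9 (b)): a surjective `ρ̄_{E,5}` is irreducible (tree
`hasIrreducibleModPGaloisRep_of_hasSurjectiveModNGaloisRep`).
[cite: BhargavaSkinnerZhang2014, Lemma 20 (p. 10)] -/
theorem W₅.irreducible {AB : ℤ × ℤ} (h : W₅ AB) (hfam : IsInHeightFamily AB) :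
    (shortWeierstrass AB).HasIrreducibleModPGaloisRep 5 := by
  haveI := isElliptic_shortWeierstrass hfam
  haveI : Fact (Nat.Prime 5) := ⟨Nat.prime_five⟩
  haveI : NeZero ((5 : ℕ) : ℚ) := ⟨by norm_num⟩
  exact hasIrreducibleModPGaloisRep_of_hasSurjectiveModNGaloisRep (shortWeierstrass AB) 5
    (by exact_mod_cast h.surjective)

/-- `W ∋ E_{A,B}` gives non-CM (a curve with a prime of multiplicative reduction has non-integral
`j`, tree `not_hasCM_of_hasMultiplicativeReductionAtPrime'`) — Kim's hypothesis on the slice `P`.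
[cite: BhargavaSkinnerZhang2014, Lemma 20 (p. 10)] -/
theorem W₅.not_hasCM {AB : ℤ × ℤ} (h : W₅ AB) (hfam : IsInHeightFamily AB) :
    ¬ (shortWeierstrass AB).HasCM := by
  haveI := isElliptic_shortWeierstrass hfam
  obtain ⟨ℓ, iℓ, -, hmult, -⟩ := h.one_ramified
  exact not_hasCM_of_hasMultiplicativeReductionAtPrime' (shortWeierstrass AB) hmult

/-- **The binder `hWtors` of `bsz_rankLeOne_cRank_of_pieces` on `W := Pieces.W₅`**, unconditional:
for `(A, B)` in the height family with `ρ̄_{E_{A,B},5}` surjective, `E_{A,B}(ℚ)[5] = 0`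
("Since `E(ℚ)[p]` is trivial under (b)", proof of Thm. 9; tree `bsz_hWtors_five_of_irreducible`).
[cite: BhargavaSkinnerZhang2014, proof of Thm. 9 (§2.2, p. 5) and Lemma 20 (p. 10)] -/
theorem hWtors_pieces :
    ∀ AB : ℤ × ℤ, IsInHeightFamily AB → W₅ AB →
      (shortWeierstrass AB).toAffine.Point[(5 : ℤ)] = ⊥ :=
  fun _ hfam hW ↦ bsz_hWtors_five_of_irreducible hfam (hW.irreducible hfam)

/-! ### `hker` on `P = SP'_K` -/

/-- **The binder `hker` of `bsz_rankLeOne_cRank_of_pieces` on `P := Pieces.SP' K` with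
`Z := Pieces.Z v`** (`v ∋ 5` the place of `ℚ`), unconditional: for `(A, B)` in the height family
with `E_{A,B} ∈ SP'_K` — in particular `E_{A,B}(ℚ₅)[5] = 0` —,
`#Sel₅(E_{A,B}) ≤ 5 · #Z(E_{A,B})` (`[Sel₅ : ker res₅] ≤ #E(ℚ₅)/5E(ℚ₅) = 5·#E(ℚ₅)[5] = 5`;
Bhargava–Skinner, proof of Lemma 16; tree `natCard_selmerGroup_shortWeierstrass_le_mul` with its local
input moved from `ℚ_[5]` to `ℚ_v` by `natCard_ker_nsmul_adicCompletion_eq_one_of_forall_padic`).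
[cite: BhargavaSkinner2014, Thm 7 (ii) and proof of Lemma 16] -/
theorem hker_pieces [Fact (Nat.Prime 5)] {v : HeightOneSpectrum (𝓞 ℚ)}
    (hv : ((5 : ℕ) : 𝓞 ℚ) ∈ v.asIdeal) (K : ℕ) :
    ∀ AB : ℤ × ℤ, IsInHeightFamily AB → SP' K AB →
      Nat.card ((shortWeierstrass AB).selmerGroup 5) ≤ 5 * Nat.card (Z v AB) :=
  fun AB hfam hP ↦
    natCard_selmerGroup_shortWeierstrass_le_mul hfam hv
      ((shortWeierstrass AB).natCard_ker_nsmul_adicCompletion_eq_one_of_forall_padic hv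
        hP.locallyTorsionFree)

/-! ### `h9` on `T ∩ S₁ ∩ W` -/

/-- **The binder `h9` of `bsz_rankLeOne_cRank_of_pieces` on `T := Pieces.S₁'`, `S₁ := Pieces.S₁Cond`,
`W := Pieces.W₅` — the multiplicative-at-`5` half CONDITIONAL on `hSZ` (OPEN, labelled).** For
`(A, B)` in the height family with `E_{A,B} ∈ S₀(5) ∩ S₁'(5)` (§3.1: `5 ∤ A`; `5 ∤ ord₅Δ'` if
multiplicative at `5`; `ord₅𝓛 = 1` if split), the bullet of `S₁(5)` (`5 ∤ ord_ℓΔ'` at the primes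
`ℓ ≡ ±1 (mod 5)` dividing `Δ'`), Lemma 20's `W` ((sur) at `5`, two ramified multiplicative primes
`ℓ₁ ≠ ℓ₂ > 5`) and `#Sel^(5)(E_{A,B}/ℚ) = 5`: `rank E_{A,B}(ℚ) = 1 ∧ ord_{s=1} L(E_{A,B}, s) = 1`
— `bsz_h9_five_of_zhang_of_skinnerZhang` on a global minimal model of `E_{A,B}`
(`hasGlobalMinimalModel_rat_holds`), below `hZ` (W. Zhang Thm. 1.4 (i), PUB), `hSZ` (Skinner–Zhang
Thm. 1.1, OPEN preprint claim, «literal-PRE») and `hCT` (Cassels–Tate).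
[cite: BhargavaSkinnerZhang2014, Thm. 9 (§2.2, p. 5), §3.1 (p. 8), Lemma 20 (p. 10)]
[cite: WZhang2014, Thm. 1.4 (i) (p. 197)] [claim: SkinnerZhang2014, status: under-review]
[cite: SilvermanAEC2009, VIII.8 Cor. 8.3] -/
theorem h9_pieces
    (hZ : WZhang2014.thm14i_rank_one_of_selmerCorank_eq_one)
    (hSZ : SkinnerZhang2014.thm1_1_rank_one_of_selmerCorank_eq_one_OPEN)
    (hCT : exists_casselsTate_pairing (K := ℚ)) :
    ∀ AB : ℤ × ℤ, IsInHeightFamily AB → S₁' AB → S₁Cond AB → W₅ AB →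
      Nat.card ((shortWeierstrass AB).selmerGroup 5) = 5 →
        (shortWeierstrass AB).mordellWeilRank = 1 ∧ (shortWeierstrass AB).analyticRank = 1 := by
  intro AB hfam hT hc hW hSel
  haveI := isElliptic_shortWeierstrass hfam
  haveI : Fact (Nat.Prime 5) := ⟨Nat.prime_five⟩
  obtain ⟨C, hC⟩ := hasGlobalMinimalModel_rat_holds (shortWeierstrass AB)
  have hCW : C⁻¹ • (C • shortWeierstrass AB) = shortWeierstrass AB := by
    rw [smul_smul, inv_mul_cancel, one_smul]
  exact bsz_h9_five_of_zhang_of_skinnerZhang hZ hSZ hCT hfam hCW hT.not_dvd hT.hfin hT.hL hc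
    hW.surjective hW.two_ramified hSel

/-- **The binder `h9` with `S₁ := Pieces.S₁`** (`= S₁' ∩ S₁Cond`, the printed `S₁(5)`) in the slot —
same theorem, the bullet read off `Pieces.S₁.cond`. [cite: BhargavaSkinnerZhang2014, Thm. 9 (§2.2, p. 5) and §3.1 (p. 8)]
[cite: WZhang2014, Thm. 1.4 (i) (p. 197)] [claim: SkinnerZhang2014, status: under-review] -/
theorem h9_pieces'
    (hZ : WZhang2014.thm14i_rank_one_of_selmerCorank_eq_one)
    (hSZ : SkinnerZhang2014.thm1_1_rank_one_of_selmerCorank_eq_one_OPEN)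
    (hCT : exists_casselsTate_pairing (K := ℚ)) :
    ∀ AB : ℤ × ℤ, IsInHeightFamily AB → S₁' AB → S₁ AB → W₅ AB →
      Nat.card ((shortWeierstrass AB).selmerGroup 5) = 5 →
        (shortWeierstrass AB).mordellWeilRank = 1 ∧ (shortWeierstrass AB).analyticRank = 1 :=
  fun AB hfam hT hS hW hSel ↦ h9_pieces hZ hSZ hCT AB hfam hT hS.cond hW hSel

/-! ### `h5` on the multiplicative half of `S₀ ∩ W` -/

/-- **The binder `h5` of `bsz_rankLeOne_cRank_of_pieces` on `S₀ := Pieces.S₀`, `W := Pieces.W₅`,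
MULTIPLICATIVE HALF** (`5 ∣ 4A³ + 27B²`, i.e. `E_{A,B}` multiplicative at `5`, Lemma 17): for
`(A, B)` in the height family with `5 ∤ A`, `5 ∣ 4A³ + 27B²`, `E_{A,B} ∈ W` and
`#Sel^(5)(E_{A,B}/ℚ) = 1`, `rank E_{A,B}(ℚ) = 0 ∧ ord_{s=1} L(E_{A,B}, s) = 0` —
`bsz_h5_multiplicative_five_of_thmA` with (irr) from (sur) and the (ram) prime from `W`'s two,
below modularity (`hmod`), Skinner 2016 Thm. A (`hA`), Greenberg's §4 formulas (`hGs`, `hGn`) and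
Greenberg–Stevens at `5` (`hGS`). The good-ordinary half is the sibling row's
`LeadingTermBSZRankZeroLegProofs`. [cite: BhargavaSkinnerZhang2014, Thm. 5 (§2.1, p. 5), Lemma 17 (p. 8), Lemma 20 (p. 10)]
[cite: Skinner2016PacificMC, Thm. A (§1) and Thm. C (2) (p. 173)] -/
theorem h5_pieces_multiplicative
    (hmod : nonempty_modularParametrizationData)
    (hA : Skinner2016.thmA_charIdeal_multiplicative)
    (hGs : Greenberg1999.thm41Analogue_charValue_rankZero_split_baseChange_anyPrime)
    (hGn : Greenberg1999.thm41Analogue_charValue_rankZero_numberField_anyPrime)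
    [Fact (Nat.Prime 5)]
    (hGS : ∀ (V : WeierstrassCurve ℚ) [V.IsElliptic] [V.IsGloballyMinimal],
      greenberg_stevens (W := V) (p := 5)) :
    ∀ AB : ℤ × ℤ, IsInHeightFamily AB → S₀ AB → W₅ AB →
      (5 : ℤ) ∣ 4 * AB.1 ^ 3 + 27 * AB.2 ^ 2 →
        Nat.card ((shortWeierstrass AB).selmerGroup 5) = 1 →
          (shortWeierstrass AB).mordellWeilRank = 0 ∧ (shortWeierstrass AB).analyticRank = 0 :=
  fun _ hfam h₀ hW hD hSel ↦
    bsz_h5_multiplicative_five_of_thmA hmod hA hGs hGn hGS hfam h₀ hD (hW.irreducible hfam)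
      hW.one_ramified hSel

end Literature.NumberTheory.EllipticCurves.BhargavaSkinnerZhang2014.Pieces

end
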